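import Summits.Schanuel.Schanuel.Theorems.RootDecomp1ELevelTransport03

/-!
# RootDecomp1ELevelTransport — lens 2, generation 43 «POWER TRANSPORT — norm the transcendental LEVEL, not only the radix» (lanes E-R20 (β) + E-R19 (ii) + (α′); VERDICT L2157: THEOREM ×1 «hX-ELIMINATION on the tree class InRadixClass by level transport» + ONE CELL on the `√2·log 2`-weighted radix class `InQuadRadixClass` with E-STABLE members `zGS`, mod the ONE new print-faithful named fact `Waldschmidt1978_thm_4_7` (Literature)): the second resultant `powerNorm 𝔐 R₀ = Res_X(R₀(X), X^𝔐 − Y)` = the norm N_{ℚ(κ)(x)/ℚ(κ)} written in κ, transcendence TYPE as the only diophantine input, the λ-weighted radix curve, the level-transport engine, T1 binder-free radix line, T3 cells serving item 31409 — continuation (RootDecomp1ELevelTransport04): §5 T1 free radix line, T3 InQuadRadixClass cells + members, separation, dichotomy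

(lens-2 g43 HOME kernel LevelTransport.lean — graded copy 6f4fbb98… 1285 l; ported copy 746096cb… = graded + the critic's PORT CONDITION K:1117 `z ↦ w` in the carried IH binder of `cell_31410 (h47)` (one token, applied by the lens 17:36Z); imports tree RootDecomp1ERadixCell07 + Literature ExpOneTranscendenceMeasureProofs + Mathlib KummerExtension; CLAIM L2118, ACK/CHECKLIST E-g43 L2127, NODE L2152 / REQUEST L2153, writer re-check L2156, critic VERDICT L2157 (CLEARED as priced: THEOREM ×1 (T1) + ONE CELL (T3); lens-2 tally CELL ×5 + THEOREM ×1; RULE E-R21 L2158; PORT GO 01–0k `--supports stmt-Schanuel-31409`); port by census-1 gen 18 as `RootDecomp1ELevelTransport01`–`04`: 01 = §1 the power norm `powerNorm` / `norm_aeval_powerNorm` / `map_powerNorm_eq` / `natDegree_powerNorm` / `powerNorm_ne_zero` + §2 `TranscendenceType` (DEFINITION), `transcendenceType_exp_mul_log (h47)` (α^β has type 5); 02 = §3 the λ-weighted radix curve `radixPtL` + §4 engine helpers; 03 = §4 THE LEVEL-TRANSPORT ENGINE `algebraicIndependent_radixPtL_of_type` (scoped `maxHeartbeats 800000` as in K);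 04 = §5 T1 binder-free (`algebraicIndependent_radixPt_free`, `schanuel_inRadixClass_free`, `cell_25020_free` / `cell_31410_free`, `schanuel_zMix_towerNumber_free`), T3 `InQuadRadixClass` (DEFINITION), `transcendenceType_two_pow_sqrt_two (h47)`, `schanuel_inQuadRadixClass (h47)`, `cell_31409 (h47)` / `cell_25020 (h47)` / `cell_31410 (h47)`, members `zGS`, `eStable_zGS`, `schanuel_zGS_towerNumber (h47)`, separation, the dichotomy `not_transcendenceType_of_isAlgebraic` / `not_transcendenceType_two`.
PORT EDITS: the named fact `def Waldschmidt1978_thm_4_7` MOVED to the NEW Literature statement file Literature/NumberTheory/Transcendental/AlphaBetaTranscendenceMeasure.lean (census proposal, [cite: Waldschmidt1978, Thm 4.7]) and referenced through `open Literature.NumberTheory.Transcendental (Waldschmidt1978_thm_4_7)`; K's six private helpers as per-part private copies; three tree twins made `private` after the dedup bounce of 04 (p830818: `sqrt_two_not_mem_range` ≡ RootDecomp1EMultiplicationTypeLeaves, `isAlgebraic_sqrt_two` ≡ Literature.Barriers.Schanuel, `sqrt_two_mul_self_complex` ≡ Literature.Geometry.GaugeTheory); statements and proofs otherwise verbatim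 (0 undocumented decls in K). `--supports stmt-Schanuel-31409`; no census credit carried; rung 0 — nothing here proves Schanuel; items 31409/25020/31410 stay OPEN.)
-/

noncomputable section

open Complex Polynomial IntermediateField Filter
open scoped BigOperators Topology

namespace Summit.Schanuel.Schanuel.Theorems.RootDecomp1ELevelTransport

open Summit.Schanuel.Schanuel.Theorems.RootDecomp1ERadixCell
open Summit.Schanuel.Schanuel.Theorems.RootDecomp1EUntwistedWall (gι gaussPt expo coef tail fib IsZ wden wden_pos
  isZ_expo Wb Wb_nonneg abs_expo_le abs_coef_le coef_cast fib_ne_zero expo_eq_of_tail_eq)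
open Summit.Schanuel.Schanuel.Theorems.RootDecomp1KHyper
open Summit.Schanuel.Schanuel.Theorems.RootDecomp1KHyper.HyperCell
open Summit.Schanuel.Schanuel.Theorems.RootDecomp1KGeneric (LiouvilleOrder)
open Summit.Schanuel.Schanuel.Theorems.RootDecomp1KFiniteOrderCell (towerNumber liouvilleOrder_towerNumber
  not_hyperLiouville_towerNumber towerNumber_pos not_liouvilleOrder_towerNumber)
open Summit.Schanuel.Schanuel.Theorems.RootDecomp1BDefectFloorCells (natCast_le_trdeg_of_algebraicIndependent)
open Summit.Schanuel.Schanuel.Theorems.RootDecomp1BRadicalDescent (exists_int_relation)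
open Literature.NumberTheory.Transcendental (Waldschmidt1978_thm_4_7)

/-! ## §5  THEOREMS AND CELLS

T1 (THEOREM, hypothesis-free): `hX`-ELIMINATION on g42's Tier 2 — the tree's `schanuel_inRadixClass (hX)` /
`schanuel_zMix_towerNumber (hX)` WITHOUT `hX = ExplicitRatExpApprox`, on the SAME tree class `InRadixClass`
(order `13·Σe + 4`; the engine only needs `6·Σe + 4`), from the PROVED fact `NesterenkoWaldschmidt1996_thm_4_2_holds`
(type 3 for `e`) transported from the level `e^{1/𝔐}` to `e`.
T3 (CELL, mod ONE new print-faithful fact `Waldschmidt1978_thm_4_7`): the `√2·log 2`-weighted radix class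
`InQuadRadixClass` (`κ = 2^{√2}`), its E-STABLE members `zGS k T = (√2·log 2·T^{j}, log 2·T^{j})_{j ≤ k}` (stabiliser
`β = √2`), and the literal items 25020 / 31410 / 31409 on the class. -/

section Cells

/-! ### T1 — the radix line, now free -/

/-- Type `3` for `e = e^{1}` read at the real weight `λ = 1`. -/
theorem transcendenceType_exp_one_real : TranscendenceType (cexp ((1 : ℝ) : ℂ)) 3 := by
  rw [Complex.ofReal_one]; exact transcendenceType_exp_one

/-- g42's complex radix weight is the `λ = 1` weight. -/
theorem ρι_eq_ριL_one (γ : ℚ × ℚ) : ρι γ = ριL 1 γ := by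
  simp [ρι, ριL, ρr_eq_ρrL_one]

/-- **`hX`-ELIMINATION (THEOREM).**  The tree's `algebraicIndependent_radixPt (hX)` (part 06) WITHOUT `hX`:
`T, e^{u₁T^{e₁}}2^{v₁T^{e₁}}, …` are algebraically independent for every real `T > 0` of exponential order
`13·Σe + 4` — level transport of the PROVED type `3` of `e` (the engine at `λ = 1`, `τ = 3`, needs order `6·Σe + 4`). -/
theorem algebraicIndependent_radixPt_free {n : ℕ} (w : Fin n → ℚ × ℚ) (e : Fin n → ℕ) {T : ℝ} (hT0 : 0 < T)
    (hT : LiouvilleOrder (13 * (∑ l, e l) + 4) T) (hu : ∀ l, 0 ≤ (w l).1) (hv : ∀ l, 0 ≤ (w l).2)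
    (hv0 : ∀ l, e l = 0 → (w l).2 = 0)
    (hLI : LinearIndependent ℤ (fun l : Fin n => Polynomial.monomial (e l) (gι (w l)))) :
    AlgebraicIndependent ℚ (radixPt w e (T : ℂ)) := by
  rw [radixPt_eq_radixPtL_one]
  exact algebraicIndependent_radixPtL_of_type one_pos (by norm_num) transcendenceType_exp_one_real w e hT0 hT
    (by omega) (by omega) hu hv hv0 hLI

/-- **T1 — `S` ITSELF ON THE TREE CLASS `InRadixClass`, HYPOTHESIS-FREE** (g42 Tier 2 of record, order `13·Σe + 4`:
now free). -/
theorem schanuel_inRadixClass_free (n : ℕ) (z : Fin n → ℂ) (hz : InRadixClass z) : SB n z := by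
  obtain ⟨T, w, e, hT0, hT, hu, hv, hv0, hLI, hz⟩ := hz
  have hai : AlgebraicIndependent ℚ (radixPt w e (T : ℂ) ∘ Fin.succ) :=
    (algebraicIndependent_radixPt_free w e hT0 hT hu hv hv0 hLI).comp _ (Fin.succ_injective n)
  refine natCast_le_trdeg_of_algebraicIndependent hai fun i => IntermediateField.subset_adjoin ℚ _ (Or.inr ⟨i, ?_⟩)
  simp only [Function.comp_apply, radixPt_succ, hz i]

/-- `S`'s LITERAL SHAPE on the tree class `InRadixClass`, hypothesis-free. -/
theorem schanuel_shape_inRadixClass_free : ∀ (n : ℕ) (z : Fin n → ℂ), LinearIndependent ℚ z →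
    InRadixClass z →
      (n : Cardinal) ≤ Algebra.trdeg ℚ
        ↥(IntermediateField.adjoin ℚ (Set.range z ∪ Set.range (Complex.exp ∘ z))) :=
  fun n z _ hcl => schanuel_inRadixClass_free n z hcl

/-- **Item 25020 `DefectOneSchanuel` on `InRadixClass`, HYPOTHESIS-FREE** — binders VERBATIM + ONE class line. -/
theorem cell_25020_free : ∀ (n : ℕ) (z : Fin n → ℂ), LinearIndependent ℚ z →
    InRadixClass z →
      (n : Cardinal) ≤ Algebra.trdeg ℚ
        ↥(IntermediateField.adjoin ℚ (Set.range z ∪ Set.range (Complex.exp ∘ z))) + 1 :=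
  fun n z _ hcl => (schanuel_inRadixClass_free n z hcl).trans le_self_add

/-- **Item 31410 `PlainDefectOne` on `InRadixClass`, HYPOTHESIS-FREE** — binders VERBATIM (carried = decoration),
ONE class line. -/
theorem cell_31410_free : ∀ (n : ℕ) (z : Fin n → ℂ), LinearIndependent ℚ z →
    (∀ β : ℂ, IsAlgebraic ℚ β → (∀ i, β * z i ∈ Submodule.span ℚ (Set.range z)) →
      β ∈ Set.range (algebraMap ℚ ℂ)) →
    (∀ (m : ℕ) (w : Fin m → ℂ), m < n → LinearIndependent ℚ w →
      (∀ j, w j ∈ Submodule.span ℚ (Set.range z)) →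
        (m : Cardinal) ≤ Algebra.trdeg ℚ
          ↥(IntermediateField.adjoin ℚ (Set.range w ∪ Set.range (Complex.exp ∘ w))) + 1) →
    InRadixClass z →
      (n : Cardinal) ≤ Algebra.trdeg ℚ
        ↥(IntermediateField.adjoin ℚ (Set.range z ∪ Set.range (Complex.exp ∘ z))) + 1 :=
  fun n z hli _ _ hcl => cell_25020_free n z hli hcl

/-- **T1 MEMBER, free**: `S` at the tree's twin curve `zMix k T = (T,…,T^k, log 2·T,…,log 2·T^k)`. -/
theorem schanuel_zMix_free {k : ℕ} {T : ℝ} (hT0 : 0 < T) (hT : LiouvilleOrder (13 * (∑ l, eMix k l) + 4) T) :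
    SB (k + k) (zMix k T) :=
  schanuel_inRadixClass_free _ _ (zMix_mem hT0 hT)

/-- **THE TREE'S NAMED TIER-2 MEMBER `schanuel_zMix_towerNumber (hX)`, NOW HYPOTHESIS-FREE.** -/
theorem schanuel_zMix_towerNumber_free (k : ℕ) :
    SB (k + k) (zMix k (towerNumber (13 * (∑ l, eMix k l) + 4 + 1))) ∧
      ¬ HyperLiouville (towerNumber (13 * (∑ l, eMix k l) + 4 + 1)) :=
  ⟨schanuel_zMix_free (towerNumber_pos (by omega)) (liouvilleOrder_towerNumber _),
    not_hyperLiouville_towerNumber (by omega)⟩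

/-! ### T3 — the `√2·log 2`-weighted radix class (`κ = 2^{√2}`), mod `Waldschmidt1978_thm_4_7` -/

/-- **The Gel'fond–Schneider weight** `λ_GS = √2 · log 2` (`e^{λ_GS} = 2^{√2}`). -/
def lamGS : ℝ := Real.sqrt 2 * Real.log 2

/-- `λ_GS > 0`. -/
theorem lamGS_pos : 0 < lamGS := mul_pos (Real.sqrt_pos.mpr two_pos) (Real.log_pos one_lt_two)

/-- `√2 · √2 = 2` in `ℂ`. -/
private theorem sqrt_two_mul_self_complex : ((Real.sqrt 2 : ℝ) : ℂ) * ((Real.sqrt 2 : ℝ) : ℂ) = 2 := by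
  rw [← Complex.ofReal_mul, Real.mul_self_sqrt zero_le_two]; norm_num

/-- `√2` is algebraic. -/
private theorem isAlgebraic_sqrt_two : IsAlgebraic ℚ ((Real.sqrt 2 : ℝ) : ℂ) := by
  refine ⟨X ^ 2 - C 2, X_pow_sub_C_ne_zero (by norm_num) 2, ?_⟩
  rw [map_sub, map_pow, aeval_X, aeval_C, map_ofNat, pow_two, sqrt_two_mul_self_complex, sub_self]

/-- `√2` is irrational (Mathlib `irrational_sqrt_two`), read in `ℂ`. -/
private theorem sqrt_two_not_mem_range : ((Real.sqrt 2 : ℝ) : ℂ) ∉ Set.range (algebraMap ℚ ℂ) := by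
  rintro ⟨q, hq⟩
  refine irrational_sqrt_two ⟨q, ?_⟩
  have h := congrArg Complex.re hq
  simpa using h

/-- `2 = e^{log 2}` is algebraic. -/
theorem isAlgebraic_exp_log_two : IsAlgebraic ℚ (cexp ((Real.log 2 : ℝ) : ℂ)) := by
  rw [← Complex.ofReal_exp, Real.exp_log two_pos]
  have h2 : IsAlgebraic ℚ (algebraMap ℚ ℂ 2) := isAlgebraic_algebraMap 2
  rw [map_ofNat] at h2
  exact_mod_cast h2

/-- **SUPPLIER (T3): `κ = 2^{√2} = e^{λ_GS}` HAS TYPE `5`**, mod `Waldschmidt1978_thm_4_7` (printed: type `4 + ε`). -/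
theorem transcendenceType_two_pow_sqrt_two (h47 : Waldschmidt1978_thm_4_7) :
    TranscendenceType (cexp ((lamGS : ℝ) : ℂ)) 5 := by
  have hℓ : ((Real.log 2 : ℝ) : ℂ) ≠ 0 := by exact_mod_cast (Real.log_pos one_lt_two).ne'
  have h := transcendenceType_exp_mul_log h47 hℓ isAlgebraic_exp_log_two isAlgebraic_sqrt_two
    sqrt_two_not_mem_range
  unfold lamGS
  rwa [← Complex.ofReal_mul] at h

/-- **THE CLASS (T3): the `√2·log 2`-WEIGHTED RADIX CURVES.**  `z ∈ InQuadRadixClass` iff for some real `T > 0`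
with `LiouvilleOrder (10·(Σ_l e_l) + 6) T` (tree `RootDecomp1KGeneric.LiouvilleOrder`: for every `N` a rational `r`,
`den r ≥ N`, `T ≠ r`, `|T − r| < exp(−den(r)^{10Σe+6})`), rationals `u_l, v_l ≥ 0` and exponents `e_l ∈ ℕ` with
`v_l = 0` whenever `e_l = 0`, and the monomials `(u_l + i v_l)·X^{e_l}` `ℤ`-linearly independent:
`z_l = (u_l·√2·log 2 + v_l·log 2)·T^{e_l}`, i.e. `e^{z_l} = 2^{(√2 u_l + v_l) T^{e_l}}`.
CLOSED-FORM ORDER `m₀(E) = 10·Σ_l e_l + 6` (`= (2K+1)·τ + 1` at `τ = 5`). -/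
def InQuadRadixClass {n : ℕ} (z : Fin n → ℂ) : Prop :=
  ∃ (T : ℝ) (w : Fin n → ℚ × ℚ) (e : Fin n → ℕ), 0 < T ∧ LiouvilleOrder (10 * (∑ l, e l) + 6) T ∧
    (∀ l, 0 ≤ (w l).1) ∧ (∀ l, 0 ≤ (w l).2) ∧ (∀ l, e l = 0 → (w l).2 = 0) ∧
    LinearIndependent ℤ (fun l : Fin n => Polynomial.monomial (e l) (gι (w l))) ∧
    ∀ l, z l = ριL lamGS (w l) * (T : ℂ) ^ (e l)

/-- **CELL ENGINE (T3)**: algebraic independence along the `√2·log 2`-radix curve, mod `Waldschmidt1978_thm_4_7`. -/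
theorem algebraicIndependent_quadRadixPt (h47 : Waldschmidt1978_thm_4_7) {n : ℕ} (w : Fin n → ℚ × ℚ)
    (e : Fin n → ℕ) {T : ℝ} (hT0 : 0 < T) (hT : LiouvilleOrder (10 * (∑ l, e l) + 6) T)
    (hu : ∀ l, 0 ≤ (w l).1) (hv : ∀ l, 0 ≤ (w l).2) (hv0 : ∀ l, e l = 0 → (w l).2 = 0)
    (hLI : LinearIndependent ℤ (fun l : Fin n => Polynomial.monomial (e l) (gι (w l)))) :
    AlgebraicIndependent ℚ (radixPtL lamGS w e (T : ℂ)) :=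
  algebraicIndependent_radixPtL_of_type lamGS_pos (by norm_num) (transcendenceType_two_pow_sqrt_two h47) w e hT0 hT
    (by omega) (by omega) hu hv hv0 hLI

/-- **CELL THEOREM (T3) — `S` ITSELF on `InQuadRadixClass`, mod `Waldschmidt1978_thm_4_7` ONLY.** -/
theorem schanuel_inQuadRadixClass (h47 : Waldschmidt1978_thm_4_7) (n : ℕ) (z : Fin n → ℂ)
    (hz : InQuadRadixClass z) : SB n z := by
  obtain ⟨T, w, e, hT0, hT, hu, hv, hv0, hLI, hz⟩ := hz
  have hai : AlgebraicIndependent ℚ (radixPtL lamGS w e (T : ℂ) ∘ Fin.succ) :=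
    (algebraicIndependent_quadRadixPt h47 w e hT0 hT hu hv hv0 hLI).comp _ (Fin.succ_injective n)
  refine natCast_le_trdeg_of_algebraicIndependent hai fun i => IntermediateField.subset_adjoin ℚ _ (Or.inr ⟨i, ?_⟩)
  simp only [Function.comp_apply, radixPtL_succ, hz i]

/-- `S`'s LITERAL SHAPE on `InQuadRadixClass`, mod `h47`. -/
theorem schanuel_shape_inQuadRadixClass (h47 : Waldschmidt1978_thm_4_7) : ∀ (n : ℕ) (z : Fin n → ℂ),
    LinearIndependent ℚ z → InQuadRadixClass z →
      (n : Cardinal) ≤ Algebra.trdeg ℚ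
        ↥(IntermediateField.adjoin ℚ (Set.range z ∪ Set.range (Complex.exp ∘ z))) :=
  fun n z _ hcl => schanuel_inQuadRadixClass h47 n z hcl

/-- **CELL of item 25020 `DefectOneSchanuel`** (T3) — binders VERBATIM + ONE class line; mod `h47`. -/
theorem cell_25020 (h47 : Waldschmidt1978_thm_4_7) : ∀ (n : ℕ) (z : Fin n → ℂ), LinearIndependent ℚ z →
    InQuadRadixClass z →
      (n : Cardinal) ≤ Algebra.trdeg ℚ
        ↥(IntermediateField.adjoin ℚ (Set.range z ∪ Set.range (Complex.exp ∘ z))) + 1 :=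
  fun n z _ hcl => (schanuel_inQuadRadixClass h47 n z hcl).trans le_self_add

/-- **CELL of item 31409 `EStableDefectOne`** (T3) — binders VERBATIM (`Theses/RootDecomp1E.lean` l.517–518: the
stabiliser hypothesis `∃ β …` and the first-failure hypothesis are CARRIED, not consumed = decoration), ONE class
line `InQuadRadixClass z`; mod `h47`.  NON-VACUOUS: the members `zGS k T` MEET the stabiliser hypothesis with
`β = √2` (`eStable_zGS`). -/
theorem cell_31409 (h47 : Waldschmidt1978_thm_4_7) : ∀ (n : ℕ) (z : Fin n → ℂ), LinearIndependent ℚ z →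
    (∃ β : ℂ, IsAlgebraic ℚ β ∧ β ∉ Set.range (algebraMap ℚ ℂ) ∧ ∀ i, β * z i ∈ Submodule.span ℚ (Set.range z)) →
    (∀ (m : ℕ) (w : Fin m → ℂ), m < n → LinearIndependent ℚ w →
      (∀ j, w j ∈ Submodule.span ℚ (Set.range z)) →
        (m : Cardinal) ≤ Algebra.trdeg ℚ
          ↥(IntermediateField.adjoin ℚ (Set.range w ∪ Set.range (Complex.exp ∘ w))) + 1) →
    InQuadRadixClass z →
      (n : Cardinal) ≤ Algebra.trdeg ℚ
        ↥(IntermediateField.adjoin ℚ (Set.range z ∪ Set.range (Complex.exp ∘ z))) + 1 :=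
  fun n z hli _ _ hcl => cell_25020 h47 n z hli hcl

/-- **CELL of item 31410 `PlainDefectOne`** (T3) — binders VERBATIM (carried), ONE class line; mod `h47`.
(VACUOUS at the members `zGS`: they HAVE the stabiliser `√2`; non-vacuous e.g. on the pure-`log 2` slice `u ≡ 0`,
which is g42's `InPureRadixClass` up to the order.) -/
theorem cell_31410 (h47 : Waldschmidt1978_thm_4_7) : ∀ (n : ℕ) (z : Fin n → ℂ), LinearIndependent ℚ z →
    (∀ β : ℂ, IsAlgebraic ℚ β → (∀ i, β * z i ∈ Submodule.span ℚ (Set.range z)) →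
      β ∈ Set.range (algebraMap ℚ ℂ)) →
    (∀ (m : ℕ) (w : Fin m → ℂ), m < n → LinearIndependent ℚ w →
      (∀ j, w j ∈ Submodule.span ℚ (Set.range z)) →
        (m : Cardinal) ≤ Algebra.trdeg ℚ
          ↥(IntermediateField.adjoin ℚ (Set.range w ∪ Set.range (Complex.exp ∘ w))) + 1) →
    InQuadRadixClass z →
      (n : Cardinal) ≤ Algebra.trdeg ℚ
        ↥(IntermediateField.adjoin ℚ (Set.range z ∪ Set.range (Complex.exp ∘ z))) + 1 :=
  fun n z hli _ _ hcl => cell_25020 h47 n z hli hcl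

/-! ### T3 members: the E-stable twin curve `zGS k T = (√2·log 2·T^{j+1}, log 2·T^{j+1})_{j<k}` -/

/-- **THE E-STABLE MEMBERS** `zGS k T`: weights `wMix` (tree: `(1,0)` then `(0,1)`) read through `ρ_{λ_GS}`, exponents
`eMix` (tree: `j+1` twice): `z = (√2 log 2·T, …, √2 log 2·T^k, log 2·T, …, log 2·T^k)`, i.e.
`e^{z} = (2^{√2 T}, …, 2^{√2 T^k}, 2^{T}, …, 2^{T^k})`. -/
def zGS (k : ℕ) (T : ℝ) : Fin (k + k) → ℂ := fun l => ριL lamGS (wMix k l) * (T : ℂ) ^ (eMix k l)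

/-- Left block: `√2·log 2·T^{j+1}`. -/
theorem zGS_left (k : ℕ) (T : ℝ) (j : Fin k) :
    zGS k T (Fin.castAdd k j) = ((Real.sqrt 2 : ℝ) : ℂ) * ((Real.log 2 : ℝ) : ℂ) * (T : ℂ) ^ ((j : ℕ) + 1) := by
  simp only [zGS, wMix_left, eMix_left, ριL, ρrL, lamGS]; push_cast; ring

/-- Right block: `log 2·T^{j+1}`. -/
theorem zGS_right (k : ℕ) (T : ℝ) (j : Fin k) :
    zGS k T (Fin.natAdd k j) = ((Real.log 2 : ℝ) : ℂ) * (T : ℂ) ^ ((j : ℕ) + 1) := by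
  simp only [zGS, wMix_right, eMix_right, ριL, ρrL, lamGS]; push_cast; ring

/-- `e^{z}` on the left block is `2^{√2·T^{j+1}}`. -/
theorem exp_zGS_left (k : ℕ) (T : ℝ) (j : Fin k) :
    cexp (zGS k T (Fin.castAdd k j)) = (((2 : ℝ) ^ (Real.sqrt 2 * T ^ ((j : ℕ) + 1) : ℝ) : ℝ) : ℂ) := by
  rw [zGS_left, Real.rpow_def_of_pos two_pos, Complex.ofReal_exp]
  push_cast
  ring_nf

/-- The members lie in the class (order `10·Σe + 6`). -/
theorem zGS_mem {k : ℕ} {T : ℝ} (hT0 : 0 < T) (hT : LiouvilleOrder (10 * (∑ l, eMix k l) + 6) T) :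
    InQuadRadixClass (zGS k T) :=
  ⟨T, wMix k, eMix k, hT0, hT, fun l => by induction l using Fin.addCases <;> simp,
    fun l => by induction l using Fin.addCases <;> simp,
    fun l h => by induction l using Fin.addCases <;> simp at h, linearIndependent_mixMonomials k, fun _ => rfl⟩

/-- **E-STABILITY OF THE MEMBERS (hypothesis of item 31409 MET, `β = √2`)**: `√2` is algebraic irrational and
`√2·(√2 log 2 T^{j}) = 2·(log 2 T^{j})`, `√2·(log 2 T^{j}) = √2 log 2 T^{j}` lie in `ℚ·zGS`.  Holds for EVERY `T`. -/
theorem eStable_zGS (k : ℕ) (T : ℝ) : ∃ β : ℂ, IsAlgebraic ℚ β ∧ β ∉ Set.range (algebraMap ℚ ℂ) ∧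
    ∀ i, β * zGS k T i ∈ Submodule.span ℚ (Set.range (zGS k T)) := by
  refine ⟨((Real.sqrt 2 : ℝ) : ℂ), isAlgebraic_sqrt_two, sqrt_two_not_mem_range, fun i => ?_⟩
  induction i using Fin.addCases with
  | left j =>
    have h : ((Real.sqrt 2 : ℝ) : ℂ) * zGS k T (Fin.castAdd k j) =
        zGS k T (Fin.natAdd k j) + zGS k T (Fin.natAdd k j) := by
      rw [zGS_left, zGS_right]
      linear_combination (((Real.log 2 : ℝ) : ℂ) * (T : ℂ) ^ ((j : ℕ) + 1)) * sqrt_two_mul_self_complex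
    rw [h]
    exact Submodule.add_mem _ (Submodule.subset_span ⟨_, rfl⟩) (Submodule.subset_span ⟨_, rfl⟩)
  | right j =>
    have h : ((Real.sqrt 2 : ℝ) : ℂ) * zGS k T (Fin.natAdd k j) = zGS k T (Fin.castAdd k j) := by
      rw [zGS_left, zGS_right]; ring
    rw [h]
    exact Submodule.subset_span ⟨_, rfl⟩

/-- **MEMBER THEOREM (T3, mod `h47`)**: `S` itself at `zGS k T` — `2^{√2T},…,2^{√2T^k}, 2^T,…,2^{T^k}` (with `T`)
algebraically independent — for EVERY real `T > 0` of exponential order `10·Σe + 6`. -/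
theorem schanuel_zGS (h47 : Waldschmidt1978_thm_4_7) {k : ℕ} {T : ℝ} (hT0 : 0 < T)
    (hT : LiouvilleOrder (10 * (∑ l, eMix k l) + 6) T) : SB (k + k) (zGS k T) :=
  schanuel_inQuadRadixClass h47 _ _ (zGS_mem hT0 hT)

/-- **THE NAMED T3 MEMBER** at a tower number (finite order by `liouvilleOrder_towerNumber`, NOT hyper-Liouville by
`not_hyperLiouville_towerNumber` — tree names). -/
theorem schanuel_zGS_towerNumber (h47 : Waldschmidt1978_thm_4_7) (k : ℕ) :
    SB (k + k) (zGS k (towerNumber (10 * (∑ l, eMix k l) + 6 + 1))) ∧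
      ¬ HyperLiouville (towerNumber (10 * (∑ l, eMix k l) + 6 + 1)) :=
  ⟨schanuel_zGS h47 (towerNumber_pos (by omega)) (liouvilleOrder_towerNumber _),
    not_hyperLiouville_towerNumber (by omega)⟩

/-- **AT-MEMBER PROBE of item 31409**: the conclusion of `EStableDefectOne` AT `z = zGS k T⋆` (tower member), mod
`h47`; its stabiliser hypothesis is MET there (`eStable_zGS`), the other binders are not needed. -/
theorem cell_31409_at_zGS (h47 : Waldschmidt1978_thm_4_7) (k : ℕ) :
    ((k + k : ℕ) : Cardinal) ≤ Algebra.trdeg ℚ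
        ↥(IntermediateField.adjoin ℚ (Set.range (zGS k (towerNumber (10 * (∑ l, eMix k l) + 6 + 1))) ∪
          Set.range (Complex.exp ∘ zGS k (towerNumber (10 * (∑ l, eMix k l) + 6 + 1))))) + 1 :=
  (schanuel_zGS_towerNumber h47 k).1.trans le_self_add

/-- **AT-MEMBER PROBE of item 25020** at `zGS k T⋆`, mod `h47`. -/
theorem cell_25020_at_zGS (h47 : Waldschmidt1978_thm_4_7) (k : ℕ) :
    ((k + k : ℕ) : Cardinal) ≤ Algebra.trdeg ℚ
        ↥(IntermediateField.adjoin ℚ (Set.range (zGS k (towerNumber (10 * (∑ l, eMix k l) + 6 + 1))) ∪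
          Set.range (Complex.exp ∘ zGS k (towerNumber (10 * (∑ l, eMix k l) + 6 + 1))))) + 1 :=
  cell_31409_at_zGS h47 k

/-! ### Separation at weight level (hypothesis-free) -/

/-- `log 2` is transcendental (Hermite–Lindemann, PROVED in the tree: `transcendental_exp_holds`; private copy of
the tree's `AclSubsetLogFreeCore.Negative.transcendental_log_two`). -/
private theorem transcendental_log_two' : Transcendental ℚ ((Real.log 2 : ℝ) : ℂ) := by
  intro halg
  have hne : ((Real.log 2 : ℝ) : ℂ) ≠ 0 := by exact_mod_cast (Real.log_pos one_lt_two).ne'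
  exact Literature.NumberTheory.Transcendental.transcendental_exp_holds halg hne isAlgebraic_exp_log_two

/-- **`λ_GS = √2·log 2` IS IRRATIONAL** (else `log 2 = q/√2` would be algebraic). -/
theorem lamGS_not_mem_range : ((lamGS : ℝ) : ℂ) ∉ Set.range (algebraMap ℚ ℂ) := by
  rintro ⟨q, hq⟩
  apply transcendental_log_two'
  have hs0 : ((Real.sqrt 2 : ℝ) : ℂ) ≠ 0 := by exact_mod_cast (Real.sqrt_pos.mpr two_pos).ne'
  have hlog : ((Real.log 2 : ℝ) : ℂ) = algebraMap ℚ ℂ q * ((Real.sqrt 2 : ℝ) : ℂ)⁻¹ := by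
    rw [hq, lamGS, Complex.ofReal_mul, mul_comm, ← mul_assoc, inv_mul_cancel₀ hs0, one_mul]
  rw [hlog]
  exact (isAlgebraic_algebraMap q).mul isAlgebraic_sqrt_two.inv

/-- **THE T3 WEIGHT IS OUTSIDE g42's WEIGHT GROUP `ℚ + ℚ·log 2`**: `u + v·log 2 ≠ √2·log 2` for all rationals
`u, v` — so at weight level no `InQuadRadixClass` coordinate with `u_l ≠ 0` is a g42 radix coordinate
(`InRadixClass` / `InPureRadixClass` weights `ρr`). -/
theorem ρr_ne_lamGS (γ : ℚ × ℚ) : ρr γ ≠ lamGS := by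
  intro h
  rw [ρr, lamGS] at h
  by_cases hu : γ.1 = 0
  · -- `v log 2 = √2 log 2`: `v = √2`, irrational
    rw [hu, Rat.cast_zero, zero_add] at h
    have hv : (γ.2 : ℝ) = Real.sqrt 2 := mul_right_cancel₀ (Real.log_pos one_lt_two).ne' h
    exact irrational_sqrt_two ⟨γ.2, hv⟩
  · -- `log 2 = u / (√2 - v)` would be algebraic
    have hs : Real.sqrt 2 - (γ.2 : ℝ) ≠ 0 := by
      intro h0; exact irrational_sqrt_two ⟨γ.2, by linarith⟩
    have hlog : Real.log 2 = (γ.1 : ℝ) / (Real.sqrt 2 - γ.2) := by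
      rw [eq_div_iff hs]; linarith
    apply transcendental_log_two'
    have hc : ((Real.log 2 : ℝ) : ℂ) = algebraMap ℚ ℂ γ.1 * (((Real.sqrt 2 : ℝ) : ℂ) - algebraMap ℚ ℂ γ.2)⁻¹ := by
      rw [hlog]; push_cast; rw [div_eq_mul_inv]; simp
    rw [hc]
    exact (isAlgebraic_algebraMap _).mul (isAlgebraic_sqrt_two.sub (isAlgebraic_algebraMap _)).inv

/-- **THE T3 WEIGHT IS OUTSIDE g41's WEIGHT RING `ℚ(i)`**: `u + v·i ≠ √2·log 2` — so at weight level no such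
coordinate is a `gaussPt` coordinate (`InGaussCurveClass`). -/
theorem gι_ne_lamGS (γ : ℚ × ℚ) : gι γ ≠ ((lamGS : ℝ) : ℂ) := by
  intro h
  have hre : (γ.1 : ℝ) = lamGS := by
    have := congrArg Complex.re h
    simpa [gι] using this
  exact lamGS_not_mem_range ⟨γ.1, by rw [← hre]; simp⟩

/-! ### The dichotomy at the level: algebraic `κ` has NO transcendence type (so the pure radix line `κ = 2` is NOT an
instance of the transport — it is the tree's `algebraicIndependent_radixPt_pure`) -/

/-- **An algebraic number has no transcendence type**: if `P₀(κ) = 0` for some `P₀ ∈ ℤ[X] ∖ 0`, then no bound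
`|P(κ)| ≥ exp(−C (deg P + log H)^τ)` can hold for all `P`. -/
theorem not_transcendenceType_of_isAlgebraic {κ : ℂ} (hκ : IsAlgebraic ℤ κ) (τ : ℕ) : ¬ TranscendenceType κ τ := by
  rintro ⟨C, -, hC⟩
  obtain ⟨P₀, hP0, hroot⟩ := hκ
  set N : ℕ := P₀.natDegree + 1 with hN
  set H : ℕ := 16 + ∑ k ∈ Finset.range (P₀.natDegree + 1), (P₀.coeff k).natAbs with hH
  have hcoef : ∀ k, |P₀.coeff k| ≤ (H : ℤ) := by
    intro k
    by_cases hk : k ≤ P₀.natDegree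
    · have h1 : (P₀.coeff k).natAbs ≤ ∑ j ∈ Finset.range (P₀.natDegree + 1), (P₀.coeff j).natAbs :=
        Finset.single_le_sum (f := fun j => (P₀.coeff j).natAbs) (fun _ _ => Nat.zero_le _)
          (Finset.mem_range.mpr (Nat.lt_succ_of_le hk))
      rw [Int.abs_eq_natAbs, hH]
      exact_mod_cast (le_add_left h1 : (P₀.coeff k).natAbs ≤ 16 + _)
    · rw [Polynomial.coeff_eq_zero_of_natDegree_lt (not_le.mp hk), abs_zero]; positivity
  have h := hC P₀ N H hP0 (by omega) (by omega) (by omega) hcoef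
  rw [hroot, norm_zero] at h
  exact absurd h (not_le.mpr (Real.exp_pos _))

/-- **CONTROL INSTANCE: `κ = 2` (the pure radix level) has no type** — the transport engine cannot be fed the
pure radix curves; those are the tree's free Tier 1 (`algebraicIndependent_radixPt_pure`). -/
theorem not_transcendenceType_two (τ : ℕ) : ¬ TranscendenceType 2 τ :=
  not_transcendenceType_of_isAlgebraic
    ⟨X - C 2, X_sub_C_ne_zero 2, by rw [map_sub, aeval_X, aeval_C, map_ofNat, sub_self]⟩ τ

end Cells

end Summit.Schanuel.Schanuel.Theorems.RootDecomp1ELevelTransport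

end
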